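import Summits.KontsevichZagierPeriods.KontsevichZagierPeriods.Theorems.RootDecompWalshStrataCone4Rung
import Summits.KontsevichZagierPeriods.KontsevichZagierPeriods.Theorems.RootDecompWalshStrataBall4Disc
import Summits.KontsevichZagierPeriods.KontsevichZagierPeriods.Theorems.RootDecompWalshStrataBakerAt

/-!
# The Lorentzian cone has weight one: descent to the Baker sector

Route `RootDecompWalshStrata` (cell decomp-kz, lens 4, gen 11), support toward `QuadricSignKernel`
(item stmt-KontsevichZagierPeriods-25393).  `RootDecompWalshStrataCone4Descent` descends the cone 4-cell
`[(0,1)⁴ ∩ {x₃² > x₀² + x₁² + x₂²}, q]` (value `q·π/24`) inside the rules to the rational 2-cell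
`Q_q = [Q, q/(3(1 + a² + b²)²)]` on the quarter disc `Q`.  One more round lands in dimension ONE:
the planar Dirichlet-polar chart `Φ(v, s) = (s(1 − v), sv)` of `RootDecompWalshStrataBall4Disc`
(rule (2): `|det Φ'| = s`, `a² + b² = s²((1 − v)² + v²)`, `Φ(D₁) = Q`) pulls the weight back to
`q·s/(3(1 + s²G(v))²)`, `G(v) = (1 − v)² + v²`, which has the RATIONAL primitive `−q/(6G(v)(1 + s²G(v)))`
along `s`; Newton–Leibniz over `(0,1)` with the algebraic edge `s = 1/√G(v)` (rule (3)) and opening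
the fibres (rule (1a)) give `Q_q ≡ arcRep (q/6) = [(0,1), (q/6)/(2G(v))]`, a RATIONAL 1-cell.  Hence
`bakerDescentAt_cone4 : QuadricBakerDescentAt cone4Poly` — the cone is in the weight-one class, DECIDED
by Baker.  0 sorry.  [KontsevichZagier2001 §1.2 rules (1)–(3); Baker1975 Thm 2.1]
-/

noncomputable section

open Literature.NumberTheory.Transcendental
open MeasureTheory Set
open MvPolynomial (aeval X C)
open Literature.ModelTheory.ExponentialFields (IsSemialgebraic isSemialgebraic_setOf_eval_pos)
open Summit.KontsevichZagierPeriods.RootDecompWalshStrata.WalshSpanProof (isSemialgebraic_cubeSet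
  isBounded_cubeSet cellRep cellRep_domain cellRep_integrand)
open Summit.KontsevichZagierPeriods.RootDecompWalshStrata.ConeSpecimen (discPoly aeval_discPoly
  discBase isSemialgebraic_discBase)
open Summit.KontsevichZagierPeriods.RootDecompWalshStrata.Ball4 (ivSet isSemialgebraic_ivSet
  ivSet_subset_Icc arcRep arcRep_domain arcRep_integrand isRational_arcRep half_le_gq
  dSrcSet mem_dSrcSet isSemialgebraic_dSrcSet dSrcSet_subset_Icc phiPoly phi phi_zero phi_one phi'
  phi'_det hasFDerivAt_phi injOn_phi image_phi dEdge isSemialgebraicFunOn_dEdge dEdge_sq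
  mem_dSrcSet_iff_init band_ivSet_subset_Icc)
open Summit.KontsevichZagierPeriods.RootDecompWalshStrata.BakerAt (QuadricBakerDescentAt
  bakerDescentAt_of_cellRep sum_mem_relations_of_bakerDescentAt_single)
open Summit.KontsevichZagierPeriods.RootDecompWalshStrata.QuadricFourRung (totalDegree_cone4Poly_le)

namespace Summit.KontsevichZagierPeriods.RootDecompWalshStrata.Cone4

/-- `G(v) = (1 − v)² + v² > 0` (from the landed bound `half_le_gq`). [folklore] -/
private theorem gPos (v : ℝ) : 0 < (1 - v) ^ 2 + v ^ 2 := one_half_pos.trans_le (half_le_gq v)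

/-- Last coordinate of `Fin.snoc` on `ℝ¹ × ℝ`. [definition] -/
private theorem snoc_one_eq (t : Fin 1 → ℝ) (s : ℝ) : (Fin.snoc t s : Fin 2 → ℝ) 1 = s := rfl

/-- First coordinate of `Fin.snoc` on `ℝ¹ × ℝ`. [definition] -/
private theorem snoc_zero_eq (t : Fin 1 → ℝ) (s : ℝ) : (Fin.snoc t s : Fin 2 → ℝ) 0 = t 0 := rfl

/-- The pulled-back denominator `3(1 + s²G(v))² > 0`. [folklore] -/
theorem cden_pos (y : Fin 2 → ℝ) : 0 < 3 * (1 + y 1 ^ 2 * ((1 - y 0) ^ 2 + y 0 ^ 2)) ^ 2 := by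
  have hG := gPos (y 0)
  positivity

/-! #### The source representation `[D₁, q·s/(3(1 + s²G(v))²)]` of the planar chart -/

/-- The pulled-back weight is continuous on `ℝ²`. [folklore] -/
theorem continuous_cWeight (q : ℚ) :
    Continuous fun y : Fin 2 → ℝ =>
      (q : ℝ) * y 1 / (3 * (1 + y 1 ^ 2 * ((1 - y 0) ^ 2 + y 0 ^ 2)) ^ 2) :=
  (continuous_const.mul (continuous_apply 1)).div (by fun_prop) fun y => (cden_pos y).ne'

/-- `[D₁, q·s/(3(1 + s²G(v))²)]`: the source representation of the planar chart for the weight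
`q/(3(1 + a² + b²)²)` (coordinates `y = (v, s)`). [KontsevichZagier2001 §1.1] -/
def cdSrcRep (q : ℚ) : KZ.IntegralRep 2 where
  domain := dSrcSet
  integrand y := (q : ℝ) * y 1 / (3 * (1 + y 1 ^ 2 * ((1 - y 0) ^ 2 + y 0 ^ 2)) ^ 2)
  isSemialgebraic_domain := isSemialgebraic_dSrcSet
  isSemialgebraicFunOn_integrand :=
    (isSemialgebraicFunOn_aeval_div_aeval isSemialgebraic_dSrcSet (C q * X 1)
      (3 * (1 + X 1 ^ 2 * ((1 - X 0) ^ 2 + X 0 ^ 2)) ^ 2) fun y _ => by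
        simpa using (cden_pos y).ne').congr fun y _ => by simp
  integrableOn :=
    ((continuous_cWeight q).continuousOn.integrableOn_compact isCompact_Icc).mono_set
      dSrcSet_subset_Icc

/-- The domain of the source representation. [definition] -/
@[simp] theorem cdSrcRep_domain (q : ℚ) : (cdSrcRep q).domain = dSrcSet := rfl

/-- The integrand of the source representation. [definition] -/
@[simp] theorem cdSrcRep_integrand (q : ℚ) (y : Fin 2 → ℝ) :
    (cdSrcRep q).integrand y = (q : ℝ) * y 1 / (3 * (1 + y 1 ^ 2 * ((1 - y 0) ^ 2 + y 0 ^ 2)) ^ 2) :=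
  rfl

/-- `|Φ(v, s)|² = s²G(v)`. [calculus] -/
theorem phi_normSq (y : Fin 2 → ℝ) :
    (y 1 * (1 - y 0)) ^ 2 + (y 1 * y 0) ^ 2 = y 1 ^ 2 * ((1 - y 0) ^ 2 + y 0 ^ 2) := by ring

/-- **Move (2), planar chart:** `[D₁, q·s/(3(1 + s²G)²)] − [Q, q/(3(1 + a² + b²)²)] ∈ KZ.relations`
(`|det Φ'| = s`, `a² + b² = s²G(v)`). [KontsevichZagier2001 §1.2 rule (2)] -/
theorem of_cdSrcRep_sub_of_qdRep_mem_relations (q : ℚ) :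
    KZ.of (cdSrcRep q) - KZ.of (qdRep q) ∈ KZ.relations := by
  refine KZ.changeOfVariablesRel_subset_relations
    ⟨2, cdSrcRep q, qdRep q, phi, phi', ?_,
      fun y _ => (hasFDerivAt_phi y).hasFDerivWithinAt,
      injOn_phi.mono fun y hy => (mem_dSrcSet.1 hy).2.1, ?_, fun y hy => ?_, rfl⟩
  · exact isSemialgebraicMapOn_aeval (cdSrcRep q).isSemialgebraic_domain phiPoly
  · rw [qdRep_domain, cdSrcRep_domain, image_phi]
    rfl
  · have h1 : 0 < y 1 := (mem_dSrcSet.1 hy).2.1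
    have hD : 0 < 3 * (1 + y 1 ^ 2 * ((1 - y 0) ^ 2 + y 0 ^ 2)) ^ 2 := cden_pos y
    rw [cdSrcRep_integrand, qdRep_integrand, phi'_det, abs_neg, abs_of_pos h1, phi_zero, phi_one,
      show 1 + (y 1 * (1 - y 0)) ^ 2 + (y 1 * y 0) ^ 2 = 1 + y 1 ^ 2 * ((1 - y 0) ^ 2 + y 0 ^ 2) by
        ring]
    field_simp

/-! #### Moves (3) + (1a): `[D₁, q·s/(3(1 + s²G)²)] ≡ arcRep (q/6)` -/

/-- **Moves (3) + (1a):** Newton–Leibniz along `s` with the RATIONAL primitive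
`−q/(6G(v)(1 + s²G(v)))` over `(0,1)` (closed fibres `[0, 1/√G(v)]`; at the top edge `s²G = 1`), then
opening the fibres: `[D₁, q·s/(3(1 + s²G)²)] − arcRep (q/6) ∈ KZ.relations` (`2 → 1`).
[KontsevichZagier2001 §1.2 rules (1), (3)] -/
theorem of_cdSrcRep_sub_of_arcRep_mem_relations (q : ℚ) :
    KZ.of (cdSrcRep q) - KZ.of (arcRep (q / 6)) ∈ KZ.relations := by
  have hBs := isSemialgebraic_ivSet
  have ha : IsSemialgebraicFunOn ℚ ivSet (fun _ => (0:ℝ)) := by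
    simpa using isSemialgebraicFunOn_ratCast hBs 0
  have hb : IsSemialgebraicFunOn ℚ ivSet dEdge := isSemialgebraicFunOn_dEdge
  have hband : IsSemialgebraic ℚ (KZlog.band ivSet (fun _ => (0:ℝ)) dEdge) :=
    KZlog.isSemialgebraic_band ha hb
  set F : (Fin 2 → ℝ) → ℝ := fun y =>
    -(q : ℝ) / (6 * ((1 - y 0) ^ 2 + y 0 ^ 2) * (1 + y 1 ^ 2 * ((1 - y 0) ^ 2 + y 0 ^ 2))) with hFdef
  have hbdry : ∀ t ∈ ivSet,
      F (Fin.snoc t (dEdge t)) - F (Fin.snoc t ((fun _ => (0:ℝ)) t)) = (arcRep (q / 6)).integrand t := by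
    intro t _
    simp only [hFdef, snoc_one_eq, snoc_zero_eq, arcRep_integrand]
    rw [dEdge_sq t]
    have hG0 := (gPos (t 0)).ne'
    push_cast
    field_simp
    ring
  obtain ⟨rb, rd, hrbd, hrbi, hrdd, hrdi, hrel⟩ := KZ.exists_band_newtonLeibniz hBs
    (fun _ => (0:ℝ)) dEdge ha hb (fun _ _ => Real.sqrt_nonneg _) F
    (fun y => (q : ℝ) * y 1 / (3 * (1 + y 1 ^ 2 * ((1 - y 0) ^ 2 + y 0 ^ 2)) ^ 2))
    ((isSemialgebraicFunOn_aeval_div_aeval hband (C (-q))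
      (6 * ((1 - X 0) ^ 2 + X 0 ^ 2) * (1 + X 1 ^ 2 * ((1 - X 0) ^ 2 + X 0 ^ 2))) fun y _ => by
        have hG := gPos (y 0)
        have h : (0:ℝ) < 6 * ((1 - y 0) ^ 2 + y 0 ^ 2) * (1 + y 1 ^ 2 * ((1 - y 0) ^ 2 + y 0 ^ 2)) := by
          positivity
        simpa using h.ne').congr fun y _ => by
        simp only [hFdef]
        simp)
    ((isSemialgebraicFunOn_aeval_div_aeval hband (C q * X 1)
      (3 * (1 + X 1 ^ 2 * ((1 - X 0) ^ 2 + X 0 ^ 2)) ^ 2) fun y _ => by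
        simpa using (cden_pos y).ne').congr fun y _ => by simp)
    (fun t _ => by
      simp only [hFdef, snoc_one_eq, snoc_zero_eq]
      have hG := gPos (t 0)
      exact (continuous_const.div (by fun_prop) fun s => by positivity).continuousOn)
    (fun t _ s _ => by
      simp only [hFdef, snoc_one_eq, snoc_zero_eq]
      have hG := gPos (t 0)
      have hD : (6 * ((1 - t 0) ^ 2 + t 0 ^ 2) * (1 + s ^ 2 * ((1 - t 0) ^ 2 + t 0 ^ 2))) ≠ 0 := by
        positivity
      have h1 : HasDerivAt
          (fun s : ℝ => 6 * ((1 - t 0) ^ 2 + t 0 ^ 2) * (1 + s ^ 2 * ((1 - t 0) ^ 2 + t 0 ^ 2)))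
          (6 * ((1 - t 0) ^ 2 + t 0 ^ 2) * ((2:ℕ) * s ^ (2 - 1) * ((1 - t 0) ^ 2 + t 0 ^ 2))) s :=
        (((hasDerivAt_pow 2 s).mul_const _).const_add 1).const_mul _
      refine ((hasDerivAt_const s (-(q : ℝ))).div h1 hD).congr_deriv ?_
      field_simp
      ring)
    (((continuous_cWeight q).continuousOn.integrableOn_compact isCompact_Icc).mono_set
      band_ivSet_subset_Icc)
    ((arcRep (q / 6)).isSemialgebraicFunOn_integrand.congr fun t ht => (hbdry t ht).symm)
    (((arcRep (q / 6)).integrableOn.congr_fun (fun t ht => (hbdry t ht).symm)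
      isSemialgebraic_ivSet.measurableSet_holds))
  obtain ⟨rb', hrb'd, hrb'i, hrel'⟩ := KZ.of_sub_of_restrict_openBand_mem_relations ha hb rb hrbd
  have hpin1 : KZ.of rb' - KZ.of (cdSrcRep q) ∈ KZ.relations := by
    refine KZ.of_sub_of_mem_relations_of_eqOn ?_ fun y _ => ?_
    · rw [hrb'd, cdSrcRep_domain]
      ext y
      exact mem_dSrcSet_iff_init y
    · rw [hrb'i, hrbi]
      rfl
  have hpin2 : KZ.of rd - KZ.of (arcRep (q / 6)) ∈ KZ.relations := by
    refine KZ.of_sub_of_mem_relations_of_eqOn ?_ fun t ht => ?_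
    · rw [arcRep_domain, hrdd]
    · rw [hrdi]
      rw [hrdd] at ht
      exact hbdry t ht
  have : KZ.of (cdSrcRep q) - KZ.of (arcRep (q / 6)) =
      (KZ.of rb - KZ.of rd) - (KZ.of rb - KZ.of rb') - (KZ.of rb' - KZ.of (cdSrcRep q)) +
        (KZ.of rd - KZ.of (arcRep (q / 6))) := by abel
  rw [this]
  exact add_mem (sub_mem (sub_mem hrel hrel') hpin1) hpin2

/-! #### Assembly: the cone is in the weight-one class -/

/-- **`[(0,1)⁴ ∩ {x₃² > x₀² + x₁² + x₂²}, q] − arcRep (q/6) ∈ KZ.relations`:** the cone 4-cell descends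
inside the rules to a RATIONAL 1-cell (`q·π/24` both sides).
[KontsevichZagier2001 §1.2; this node] -/
theorem of_cell_sub_of_arcRep_mem_relations (q : ℚ) :
    KZ.of (cellRep cone4Poly q) - KZ.of (arcRep (q / 6)) ∈ KZ.relations := by
  have h1 := of_cell_sub_of_qdRep_mem_relations q
  have h2 := of_cdSrcRep_sub_of_qdRep_mem_relations q
  have h3 := of_cdSrcRep_sub_of_arcRep_mem_relations q
  have : KZ.of (cellRep cone4Poly q) - KZ.of (arcRep (q / 6)) =
      (KZ.of (cellRep cone4Poly q) - KZ.of (qdRep q)) - (KZ.of (cdSrcRep q) - KZ.of (qdRep q)) +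
        (KZ.of (cdSrcRep q) - KZ.of (arcRep (q / 6))) := by abel
  rw [this]
  exact add_mem (sub_mem h1 h2) h3

/-- **The Lorentzian cone has weight one:** `QuadricBakerDescentAt cone4Poly` — decided INSIDE the
rules. [KontsevichZagier2001 §1.2; this node] -/
theorem bakerDescentAt_cone4 : QuadricBakerDescentAt cone4Poly :=
  bakerDescentAt_of_cellRep fun _ q =>
    ⟨KZ.of (arcRep (q / 6)),
      AddSubgroup.subset_closure ⟨1, arcRep (q / 6), le_rfl, isRational_arcRep _, rfl⟩,
      of_cell_sub_of_arcRep_mem_relations q⟩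

/-- **Conjecture 1 (kernel form) HOLDS for the cone cells, unconditionally:** every vanishing
`ℤ`-combination of representations `[(0,1)⁴ ∩ {x₃² > x₀² + x₁² + x₂²}, qᵢ]` is a Kontsevich–Zagier
relation. [Baker1975 Thm 2.1; KontsevichZagier2001 §1.2; this node] -/
theorem sum_mem_relations_cone4 (k : ℕ) (q : Fin k → ℚ) (ρ : Fin k → KZ.IntegralRep 4)
    (c : Fin k → ℤ)
    (hρ : ∀ i, (ρ i).domain = {x | (∀ j, 0 < x j ∧ x j < 1) ∧ 0 < MvPolynomial.aeval x cone4Poly} ∧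
      ∀ x ∈ (ρ i).domain, (ρ i).integrand x = (q i : ℝ))
    (hv : KZ.eval (∑ i, c i • KZ.of (ρ i)) = 0) : (∑ i, c i • KZ.of (ρ i)) ∈ KZ.relations :=
  sum_mem_relations_of_bakerDescentAt_single bakerDescentAt_cone4 totalDegree_cone4Poly_le k q ρ c
    hρ hv

end Summit.KontsevichZagierPeriods.RootDecompWalshStrata.Cone4

end
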